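import Literature.Analysis.FluidPDE.NewtonPotentialTestSource
import Literature.Analysis.FluidPDE.NormalisedPressureLpBoundProofs
import Literature.Analysis.FluidPDE.SpaceTimeMollifier
import HarnessLib

/-!
# The Newtonian potential of a third derivative off the support: the far-field kernel `D³Γ`

Analysis/FluidPDE support file (theorems only) in the decomposition of the named fact
`Literature.Analysis.FluidPDE.leray_solution_ckn_decay` (Kang–Miura–Tsai 2021, Lemmas 3.3–3.4)
through the slice oscillation estimate of `LerayPressureDecayReduction.lean`. In the local
pressure expansion of Kang–Miura–Tsai (arXiv:1812.10509, Lemma 3.4 / App. 1 p. 18) the far-field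
pressure is `p_far(x,t) = ∫ (K(x-y) - K(x₀-y)) : ((1-ψ) v ⊗ v)(y,t) dy`, `K = ∇²(1/4π|x|)`, and its
gradient is the absolutely convergent integral of `D³Γ(x - y)` against `(1-ψ) v ⊗ v`. The identity
behind this — moving three derivatives from a density supported away from the point onto the
Newtonian kernel — is proved here:

* `integral_fderiv3_mul_newtonKernel_comp_sub` — for `g ∈ C^∞_c(ℝ³)` vanishing on a ball
  `B(y, δ)` and directions `a, b, c`,
  `∫ (∂_c∂_b∂ₐ g)(t) Γ(y - t) dt = ∫ g(t) (∂ₐ∂_b∂_c Γ)(y - t) dt`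
  (three integrations by parts; on the support of `g` the kernel `Γ(y - ·)` is smooth, and it may
  be replaced everywhere by the smooth `Γ∞(y - ·)` without changing either integrand);
* `exists_bound_fderiv3_dir_newtonKernel` — the kernel bound
  `|(∂ₐ∂_b∂_c Γ)(z)| ≤ M |a||b||c| |z|⁻⁴` for `z ≠ 0` (from the tree's `‖D³Γ(z)‖ ≤ M₃|z|⁻⁴`,
  `exists_bound_fderiv3_newtonKernel`), and the identification of the iterated directional
  derivative with the trilinear `D³Γ(z)(a,b,c)` off the origin
  (`fderiv3_dir_newtonKernel_eq`).

## References

* D. Gilbarg, N. S. Trudinger, *Elliptic partial differential equations of second order*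
  (2001), Lemma 4.1–4.2 and (4.9)–(4.10) (derivatives of the Newtonian potential). [GilbargTrudinger2001]
* K. Kang, H. Miura, T.-P. Tsai, IMRN 2021 = arXiv:1812.10509, App. 1, proof of Lemma 3.4,
  p. 18 (the far-field pressure and its pointwise bound). [KangMiuraTsai2020]
-/

noncomputable section

open MeasureTheory Set Filter Topology Function Metric ContinuousLinearMap
open scoped ENNReal NNReal Convolution ContDiff

namespace Literature.Analysis.FluidPDE

-- nested operator types `ℝ³ →L[ℝ] ℝ³ →L[ℝ] ℝ³ →L[ℝ] ℝ`
set_option maxSynthPendingDepth 3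

section OffSupport

variable {F' : Type*} [NormedAddCommGroup F'] [NormedSpace ℝ F']

/-- A function vanishing on an open ball has vanishing derivative there. [folklore] -/
theorem fderiv_eq_zero_of_forall_mem_ball {g : EuclideanSpace ℝ (Fin 3) → F'}
    {y : EuclideanSpace ℝ (Fin 3)} {δ : ℝ} (h : ∀ t ∈ ball y δ, g t = 0)
    {t : EuclideanSpace ℝ (Fin 3)} (ht : t ∈ ball y δ) : fderiv ℝ g t = 0 := by
  have : g =ᶠ[𝓝 t] fun _ => (0 : F') :=
    eventually_of_mem (isOpen_ball.mem_nhds ht) fun s hs => h s hs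
  rw [this.fderiv_eq, fderiv_const_apply]

/-- A directional derivative of a function vanishing on an open ball vanishes there. [folklore] -/
theorem fderiv_apply_eq_zero_of_forall_mem_ball {g : EuclideanSpace ℝ (Fin 3) → F'}
    {y : EuclideanSpace ℝ (Fin 3)} {δ : ℝ} (h : ∀ t ∈ ball y δ, g t = 0)
    (a : EuclideanSpace ℝ (Fin 3)) : ∀ t ∈ ball y δ, fderiv ℝ g t a = 0 := fun t ht => by
  simp [fderiv_eq_zero_of_forall_mem_ball h ht]

/-- If `φ₁ = φ₂` near `z`, their directional derivative functions agree near `z`. [folklore] -/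
theorem eventuallyEq_fderiv_apply_of_eventuallyEq {φ₁ φ₂ : EuclideanSpace ℝ (Fin 3) → F'}
    {z : EuclideanSpace ℝ (Fin 3)} (h : φ₁ =ᶠ[𝓝 z] φ₂) (v : EuclideanSpace ℝ (Fin 3)) :
    (fun s => fderiv ℝ φ₁ s v) =ᶠ[𝓝 z] fun s => fderiv ℝ φ₂ s v := by
  filter_upwards [h.fderiv (𝕜 := ℝ)] with s hs
  rw [hs]

/-! ### The kernel `∂ₐ∂_b∂_c Γ` -/

/-- **The iterated directional third derivative of `Γ` is the trilinear `D³Γ` off the origin**: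
for `z ≠ 0`, `∂ₐ(∂_b(∂_c Γ))(z) = D³Γ(z)(a)(b)(c)`. [folklore] -/
theorem fderiv3_dir_newtonKernel_eq {z : EuclideanSpace ℝ (Fin 3)} (hz : z ≠ 0)
    (a b c : EuclideanSpace ℝ (Fin 3)) :
    fderiv ℝ (fun s₂ => fderiv ℝ (fun s₁ => fderiv ℝ newtonKernel s₁ c) s₂ b) z a =
      fderiv ℝ (fderiv ℝ (fderiv ℝ newtonKernel)) z a b c := by
  have hU : IsOpen ({0}ᶜ : Set (EuclideanSpace ℝ (Fin 3))) := isOpen_compl_singleton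
  have hd1 : ∀ w : EuclideanSpace ℝ (Fin 3), w ≠ 0 →
      DifferentiableAt ℝ (fderiv ℝ newtonKernel) w := fun w hw =>
    ((contDiffOn_fderiv_newtonKernel (n := 1)).differentiableOn one_ne_zero).differentiableAt
      (hU.mem_nhds hw)
  have hd2 : ∀ w : EuclideanSpace ℝ (Fin 3), w ≠ 0 →
      DifferentiableAt ℝ (fderiv ℝ (fderiv ℝ newtonKernel)) w := fun w hw =>
    ((contDiffOn_fderiv2_newtonKernel (n := 1)).differentiableOn one_ne_zero).differentiableAt
      (hU.mem_nhds hw)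
  -- the inner identification holds near `z`
  have h1 : (fun s₂ => fderiv ℝ (fun s₁ => fderiv ℝ newtonKernel s₁ c) s₂ b) =ᶠ[𝓝 z]
      fun s₂ => fderiv ℝ (fderiv ℝ newtonKernel) s₂ b c := by
    filter_upwards [hU.mem_nhds hz] with w hw
    exact fderiv_apply_const_apply (hd1 w hw) c b
  rw [h1.fderiv_eq]
  -- peel the two evaluations
  have h2 : fderiv ℝ (fun s₂ => fderiv ℝ (fderiv ℝ newtonKernel) s₂ b c) z a =
      fderiv ℝ (fun s₂ => fderiv ℝ (fderiv ℝ newtonKernel) s₂ b) z a c := by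
    have hd : DifferentiableAt ℝ (fun s₂ => fderiv ℝ (fderiv ℝ newtonKernel) s₂ b) z :=
      (hd2 z hz).clm_apply (differentiableAt_const b)
    rw [fderiv_clm_apply hd (differentiableAt_const c)]
    simp
  rw [h2, fderiv_apply_const_apply (hd2 z hz) b a]

/-- **The far-field kernel bound**: there is `M ≥ 0` with
`|∂ₐ(∂_b(∂_c Γ))(z)| ≤ M |a| |b| |c| / |z|⁴` for all `z ≠ 0` and all directions
(`‖D³Γ(z)‖ ≤ M₃/|z|⁴`, `exists_bound_fderiv3_newtonKernel`). [cite: GilbargTrudinger2001, (4.10) with Lemma 4.2] -/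
theorem exists_bound_fderiv3_dir_newtonKernel :
    ∃ M : ℝ, 0 ≤ M ∧ ∀ z : EuclideanSpace ℝ (Fin 3), z ≠ 0 → ∀ a b c : EuclideanSpace ℝ (Fin 3),
      |fderiv ℝ (fun s₂ => fderiv ℝ (fun s₁ => fderiv ℝ newtonKernel s₁ c) s₂ b) z a| ≤
        M * ‖a‖ * ‖b‖ * ‖c‖ / ‖z‖ ^ 4 := by
  obtain ⟨M₃, hM₃0, hM₃⟩ := exists_bound_fderiv3_newtonKernel
  refine ⟨M₃, hM₃0, fun z hz a b c => ?_⟩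
  rw [fderiv3_dir_newtonKernel_eq hz, ← Real.norm_eq_abs]
  have hz4 : 0 < ‖z‖ ^ 4 := by positivity
  calc ‖fderiv ℝ (fderiv ℝ (fderiv ℝ newtonKernel)) z a b c‖
      ≤ ‖fderiv ℝ (fderiv ℝ (fderiv ℝ newtonKernel)) z a b‖ * ‖c‖ := le_opNorm _ _
    _ ≤ ‖fderiv ℝ (fderiv ℝ (fderiv ℝ newtonKernel)) z a‖ * ‖b‖ * ‖c‖ := by
        gcongr; exact le_opNorm _ _
    _ ≤ ‖fderiv ℝ (fderiv ℝ (fderiv ℝ newtonKernel)) z‖ * ‖a‖ * ‖b‖ * ‖c‖ := by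
        gcongr; exact le_opNorm _ _
    _ ≤ M₃ / ‖z‖ ^ 4 * ‖a‖ * ‖b‖ * ‖c‖ := by gcongr; exact hM₃ z hz
    _ = M₃ * ‖a‖ * ‖b‖ * ‖c‖ / ‖z‖ ^ 4 := by ring

/-! ### Three integrations by parts -/

/-- **Moving three derivatives onto the Newtonian kernel off the support.** Let
`g ∈ C^∞_c(ℝ³)` vanish on the ball `B(y, δ)`, `δ > 0`. Then for all directions `a, b, c`,
`∫ (∂_c∂_b∂ₐ g)(t) Γ(y - t) dt = ∫ g(t) (∂ₐ∂_b∂_c Γ)(y - t) dt`: on the support of `g` one has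
`|y - t| ≥ δ`, so `Γ(y - ·)` may be replaced by the smooth `Γ∞(y - ·)` (`newtonFar (δ/4) (δ/2)`)
in both integrands, and three whole-space integrations by parts (each producing
`∂ᵥ[Φ(y - ·)] = -(∂ᵥΦ)(y - ·)`) give the claim. [cite: GilbargTrudinger2001, Lemma 4.1–4.2] -/
theorem integral_fderiv3_mul_newtonKernel_comp_sub {g : EuclideanSpace ℝ (Fin 3) → ℝ}
    (hg : ContDiff ℝ ∞ g) (hgc : HasCompactSupport g) {y : EuclideanSpace ℝ (Fin 3)} {δ : ℝ}
    (hδ : 0 < δ) (hvan : ∀ t ∈ ball y δ, g t = 0) (a b c : EuclideanSpace ℝ (Fin 3)) :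
    ∫ t, fderiv ℝ (fun s₂ => fderiv ℝ (fun s₁ => fderiv ℝ g s₁ a) s₂ b) t c * newtonKernel (y - t) =
      ∫ t, g t * fderiv ℝ (fun s₂ => fderiv ℝ (fun s₁ => fderiv ℝ newtonKernel s₁ c) s₂ b)
        (y - t) a := by
  -- the smooth kernel
  have h₀ : 0 < δ / 4 := by positivity
  have h₁ : δ / 4 < δ / 2 := by linarith
  set Γ' : EuclideanSpace ℝ (Fin 3) → ℝ := newtonFar (δ / 4) (δ / 2) with hΓ'_def
  have hΓ' : ContDiff ℝ ∞ Γ' := contDiff_newtonFar h₀ h₁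
  -- the derivatives of `g`
  set g₁ : EuclideanSpace ℝ (Fin 3) → ℝ := fun s => fderiv ℝ g s a with hg₁_def
  set g₂ : EuclideanSpace ℝ (Fin 3) → ℝ := fun s => fderiv ℝ g₁ s b with hg₂_def
  set g₃ : EuclideanSpace ℝ (Fin 3) → ℝ := fun s => fderiv ℝ g₂ s c with hg₃_def
  have hg₁ : ContDiff ℝ ∞ g₁ := contDiff_fderiv_apply_const hg a
  have hg₂ : ContDiff ℝ ∞ g₂ := contDiff_fderiv_apply_const hg₁ b
  have hg₃ : ContDiff ℝ ∞ g₃ := contDiff_fderiv_apply_const hg₂ c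
  have hg₁c : HasCompactSupport g₁ := hgc.fderiv_apply (𝕜 := ℝ) a
  have hg₂c : HasCompactSupport g₂ := hg₁c.fderiv_apply (𝕜 := ℝ) b
  have hg₃c : HasCompactSupport g₃ := hg₂c.fderiv_apply (𝕜 := ℝ) c
  have hvan₁ : ∀ t ∈ ball y δ, g₁ t = 0 := fderiv_apply_eq_zero_of_forall_mem_ball hvan a
  have hvan₂ : ∀ t ∈ ball y δ, g₂ t = 0 := fderiv_apply_eq_zero_of_forall_mem_ball hvan₁ b
  have hvan₃ : ∀ t ∈ ball y δ, g₃ t = 0 := fderiv_apply_eq_zero_of_forall_mem_ball hvan₂ c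
  -- the derivatives of the kernel and their reflected translates
  set φ₁ : EuclideanSpace ℝ (Fin 3) → ℝ := fun s => fderiv ℝ Γ' s c with hφ₁_def
  set φ₂ : EuclideanSpace ℝ (Fin 3) → ℝ := fun s => fderiv ℝ φ₁ s b with hφ₂_def
  set φ₃ : EuclideanSpace ℝ (Fin 3) → ℝ := fun s => fderiv ℝ φ₂ s a with hφ₃_def
  have hφ₁ : ContDiff ℝ ∞ φ₁ := contDiff_fderiv_apply_const hΓ' c
  have hφ₂ : ContDiff ℝ ∞ φ₂ := contDiff_fderiv_apply_const hφ₁ b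
  have hφ₃ : ContDiff ℝ ∞ φ₃ := contDiff_fderiv_apply_const hφ₂ a
  set k₀ : EuclideanSpace ℝ (Fin 3) → ℝ := fun t => Γ' (y - t) with hk₀_def
  set k₁ : EuclideanSpace ℝ (Fin 3) → ℝ := fun t => φ₁ (y - t) with hk₁_def
  set k₂ : EuclideanSpace ℝ (Fin 3) → ℝ := fun t => φ₂ (y - t) with hk₂_def
  set k₃ : EuclideanSpace ℝ (Fin 3) → ℝ := fun t => φ₃ (y - t) with hk₃_def
  have hrefl : ContDiff ℝ ∞ fun t : EuclideanSpace ℝ (Fin 3) => y - t :=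
    contDiff_const.sub contDiff_id
  have hk₀ : ContDiff ℝ ∞ k₀ := hΓ'.comp hrefl
  have hk₁ : ContDiff ℝ ∞ k₁ := hφ₁.comp hrefl
  have hk₂ : ContDiff ℝ ∞ k₂ := hφ₂.comp hrefl
  have hk₃ : ContDiff ℝ ∞ k₃ := hφ₃.comp hrefl
  have hD₀ : ∀ t, fderiv ℝ k₀ t c = -k₁ t := fun t =>
    fderiv_comp_const_sub_apply (hΓ'.of_le one_le_infty) y t c
  have hD₁ : ∀ t, fderiv ℝ k₁ t b = -k₂ t := fun t =>
    fderiv_comp_const_sub_apply (hφ₁.of_le one_le_infty) y t b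
  have hD₂ : ∀ t, fderiv ℝ k₂ t a = -k₃ t := fun t =>
    fderiv_comp_const_sub_apply (hφ₂.of_le one_le_infty) y t a
  -- off the ball the smooth kernel and its derivatives are those of `Γ`
  have hfar : ∀ t : EuclideanSpace ℝ (Fin 3), t ∉ ball y δ → δ / 2 < ‖y - t‖ := by
    intro t ht
    rw [mem_ball, dist_eq_norm, not_lt, norm_sub_rev] at ht
    linarith
  have hL : ∀ t, g₃ t * newtonKernel (y - t) = k₀ t * g₃ t := by
    intro t
    by_cases ht : t ∈ ball y δ
    · rw [hvan₃ t ht, zero_mul, mul_zero]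
    · rw [hk₀_def]
      dsimp only
      rw [hΓ'_def, newtonFar_eq_newtonKernel h₀.le h₁ (hfar t ht).le, mul_comm]
  have hR : ∀ t, g t * fderiv ℝ (fun s₂ => fderiv ℝ (fun s₁ => fderiv ℝ newtonKernel s₁ c) s₂ b)
      (y - t) a = k₃ t * g t := by
    intro t
    by_cases ht : t ∈ ball y δ
    · rw [hvan t ht, zero_mul, mul_zero]
    · have e0 : Γ' =ᶠ[𝓝 (y - t)] newtonKernel :=
        newtonFar_eventuallyEq_newtonKernel h₀.le h₁ (hfar t ht)
      have e1 : φ₁ =ᶠ[𝓝 (y - t)] fun s => fderiv ℝ newtonKernel s c :=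
        eventuallyEq_fderiv_apply_of_eventuallyEq e0 c
      have e2 : φ₂ =ᶠ[𝓝 (y - t)] fun s₂ => fderiv ℝ (fun s₁ => fderiv ℝ newtonKernel s₁ c) s₂ b :=
        eventuallyEq_fderiv_apply_of_eventuallyEq e1 b
      have e3 : φ₃ (y - t) =
          fderiv ℝ (fun s₂ => fderiv ℝ (fun s₁ => fderiv ℝ newtonKernel s₁ c) s₂ b) (y - t) a := by
        rw [hφ₃_def]
        dsimp only
        rw [e2.fderiv_eq]
      rw [hk₃_def]
      dsimp only
      rw [e3, mul_comm]
  -- integrability of all products (compact support from the `g`-factor)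
  have hint : ∀ {k f : EuclideanSpace ℝ (Fin 3) → ℝ}, Continuous k → Continuous f →
      HasCompactSupport f → Integrable (fun t => k t * f t) := fun hk hf hfc =>
    (hk.mul hf).integrable_of_hasCompactSupport hfc.mul_left
  have hc₀ : Continuous k₀ := hk₀.continuous
  have hc₁ : Continuous k₁ := hk₁.continuous
  have hc₂ : Continuous k₂ := hk₂.continuous
  have hc₃ : Continuous k₃ := hk₃.continuous
  have hcD₀ : Continuous fun t => fderiv ℝ k₀ t c := (contDiff_fderiv_apply_const hk₀ c).continuous
  have hcD₁ : Continuous fun t => fderiv ℝ k₁ t b := (contDiff_fderiv_apply_const hk₁ b).continuous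
  have hcD₂ : Continuous fun t => fderiv ℝ k₂ t a := (contDiff_fderiv_apply_const hk₂ a).continuous
  have hdiff : ∀ {f : EuclideanSpace ℝ (Fin 3) → ℝ}, ContDiff ℝ ∞ f → ∀ t, DifferentiableAt ℝ f t :=
    fun hf t => (hf.differentiable (by simp)) t
  -- the computation
  calc ∫ t, g₃ t * newtonKernel (y - t)
      = ∫ t, k₀ t * fderiv ℝ g₂ t c := integral_congr_ae (Eventually.of_forall hL)
    _ = -∫ t, fderiv ℝ k₀ t c * g₂ t :=
        integral_mul_fderiv_eq_neg_fderiv_mul_of_integrable (hint hcD₀ hg₂.continuous hg₂c)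
          (hint hc₀ hg₃.continuous hg₃c) (hint hc₀ hg₂.continuous hg₂c)
          (fun t _ => hdiff hk₀ t) (fun t _ => hdiff hg₂ t)
    _ = ∫ t, k₁ t * fderiv ℝ g₁ t b := by
        rw [← integral_neg]
        refine integral_congr_ae (Eventually.of_forall fun t => ?_)
        dsimp only
        rw [hD₀ t]
        ring
    _ = -∫ t, fderiv ℝ k₁ t b * g₁ t :=
        integral_mul_fderiv_eq_neg_fderiv_mul_of_integrable (hint hcD₁ hg₁.continuous hg₁c)
          (hint hc₁ hg₂.continuous hg₂c) (hint hc₁ hg₁.continuous hg₁c)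
          (fun t _ => hdiff hk₁ t) (fun t _ => hdiff hg₁ t)
    _ = ∫ t, k₂ t * fderiv ℝ g t a := by
        rw [← integral_neg]
        refine integral_congr_ae (Eventually.of_forall fun t => ?_)
        dsimp only
        rw [hD₁ t]
        ring
    _ = -∫ t, fderiv ℝ k₂ t a * g t :=
        integral_mul_fderiv_eq_neg_fderiv_mul_of_integrable (hint hcD₂ hg.continuous hgc)
          (hint hc₂ hg₁.continuous hg₁c) (hint hc₂ hg.continuous hgc)
          (fun t _ => hdiff hk₂ t) (fun t _ => hdiff hg t)
    _ = ∫ t, k₃ t * g t := by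
        rw [← integral_neg]
        refine integral_congr_ae (Eventually.of_forall fun t => ?_)
        dsimp only
        rw [hD₂ t]
        ring
    _ = _ := integral_congr_ae (Eventually.of_forall fun t => (hR t).symm)

end OffSupport

end Literature.Analysis.FluidPDE
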